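import Literature.AlgebraicGeometry.Frobenioids.ArithmeticFrobenioidThm64iiiGeneralOfSquare
import Literature.AlgebraicGeometry.Frobenioids.ArithmeticPerfectionUntrToRlf
import HarnessLib

/-!
# Frobenioids I, Theorem 6.4 (iii) AT THE CONSTRUCTIONS, arbitrary `Ψ′`, AT THE COMPARISON FUNCTORS
# `((C_{K_i/F_i})^pf)^un-tr → C_{K_i/F_i}^rlf` of Prop. 5.3 — the last binders `u_i`, `β_i`, `hu_i` INSTANTIATED
# (row «T64iii-ARBITRARY-Ψ′», L1-lead gen 7 «GO L1-d2 T64iii-AT-COMPARISON»)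

Mochizuki, *The geometry of Frobenioids I: the general theory*, Kyushu J. Math. **62** (2008) 293–400,
§6, Thm. 6.4 (iii) pp. 114–115 ("If the equivalence of categories `Ψ^rlf` of (ii) arises from an
equivalence of categories `(Ψ^pf)^un-tr : (C₁^pf)^un-tr ⥲ (C₂^pf)^un-tr` between the unit-trivialized
perfections of `C₁`, `C₂` [cf. (i) and Corollary 5.4], then `deg(Ψ^rlf) ∈ ℚ_{>0}`.  In particular, … the
bijection `V(L₁) ⥲ Prime(Φ₁(L₁)) ⥲ Prime(Φ₂(L₂)) ⥲ V(L₂)` induced by `(Ψ^pf)^un-tr` [cf. (i) and Corollary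
4.11, (iii)] maps a valuation `v₁ ∈ V(L₁)` lying over a valuation `v₀` of `ℚ` to a valuation `v₂ ∈ V(L₂)`
lying over the valuation `v₀` of `ℚ`"), proof p. 116 l. 4–16; §5, Prop. 5.3 p. 103 ("there is a natural
1-commutative diagram of functors … `C^un-tr → (C^un-tr)^pf → C^rlf` … the functors that arise naturally from
the construction"), Prop. 5.5 (ii) p. 104. [cite: MochizukiFrdI2008, Thm. 6.4 (iii) p.114]
[cite: MochizukiFrdI2008, Prop. 5.3 p.103]

PROOF-ONLY knit (cell abc-iut, seat abc-iut-L1-d2 gen 5).  abc-iut-L1-d2's `Thm64iii_arith_general_of_square`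
(`ArithmeticFrobenioidThm64iiiGeneralOfSquare.lean`: abc-iut-L1-t3's knit `Thm64iii_arith_general_of_transportCompat`
with its hypothesis `hG2` discharged) holds for EVERY pair of "comparison functors" `u_i : ((C_i)^pf)^un-tr → C_i^rlf`
lying over `D_i` up to `β_i : u_i ⋙ Base ≅ Base` with the Div-clause `Div(u_i φ) = β_i^* ι(Div φ)`; abc-iut-L1-d1's
`arith_exists_comparisonFunctor_pfUntr_rlf_degFr` (`ArithmeticPerfectionUntrToRlf.lean`) EXHIBITS, at THE data,
THE functor of Prop. 5.3 (the composite Prop. 5.5 (ii) `((C)^pf)^un-tr ⥲ ((C)^un-tr)^pf ⥲` model of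
`(Φ^pf, ℚ · Φ^birat)` `→ C^rlf`) with such a `β` and Div-clause, also preserving Frobenius degrees.  This file
composes the two (`Exists.elim`), after recording that the transport `θ` of the corollary is PINNED by its Div-clause:

* `arith_transport_unique_of_divClause` — two maps `Φ₁^pf(Base u₁A₁) → Φ₂^pf(Base u₂Ψ′A₁)` carrying
  `β₁^* Div φ ↦ β₂^* Div(Ψ′φ)` for every arrow `φ` out of `A₁` COINCIDE (every element of `Φ₁^pf(Base A₁)` is a
  `Div` out of `A₁`, Def. 1.3 (iii)(d); `β₁^*` is bijective) — so the `θ` of `Thm64iii_arith_general_of_square`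
  IS "the bijection … induced by `(Ψ^pf)^un-tr` [cf. Corollary 4.11, (iii)]";
* `Thm64iii_arith_general_at_comparison` — THERE EXIST the comparison functors `u_i` with base isomorphisms
  `β_i`, lying over `F_ι : F_{Φ^pf} → F_{Φ^rlf}` in all three coordinates (`Base`, `Div`, `deg_Fr`), such that for
  EVERY equivalence `Ψ′ : ((C₁)^pf)^un-tr ⥲ ((C₂)^pf)^un-tr`, EVERY equivalence `Ψ^rlf : C₁^rlf ⥲ C₂^rlf` and
  EVERY `1`-commutative square `σ : Ψ′ ⋙ u₂ ≅ u₁ ⋙ Ψ^rlf` (print's hypothesis "`Ψ^rlf` arises from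
  `(Ψ^pf)^un-tr`", the ONE remaining binder) and every `A₁`: `∃ θ` (THE perfected divisor transport of `Ψ′` at
  `A₁`, pinned by its Div-clause), `∃ picMap` with `Thm64ii`, `∃ placeMap` induced by `θ`, and
  `∀ deg, Thm64iii R₁ R₂ Ψ^rlf picMap deg u₁ u₂ Ψ′ A₁ placeMap`.
No `def`, no instance, no named fact.  Nothing here bears on, or takes a side on, [IUTchIII] Cor. 3.12; no
statement of the paper is strengthened.
-/

noncomputable section

namespace Literature.AlgebraicGeometry.Frobenioids

open CategoryTheory Opposite PreFrobenioid Literature.AnabelianGeometry.EtaleTheta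

section Arith

variable {F₁ : Type} [Field F₁] [NumberField F₁] {K₁ : Type} [Field K₁] [Algebra F₁ K₁] [IsGalois F₁ K₁]
  {F₂ : Type} [Field F₂] [NumberField F₂] {K₂ : Type} [Field K₂] [Algebra F₂ K₂] [IsGalois F₂ K₂]
  (hΦ₁ : PreFrobenioid.IsPerfFactorialOn (arithDivisorFunctor F₁ K₁))
  (hΦ₂ : PreFrobenioid.IsPerfFactorialOn (arithDivisorFunctor F₂ K₂))

/-- **The transport is pinned by its Div-clause** ("the bijection … induced by `(Ψ^pf)^un-tr`"): for
comparison data `(u_i, β_i)`, a functor `Ψ′` and an object `A₁`, two maps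
`θ, θ′ : Φ₁^pf(Base u₁A₁) → Φ₂^pf(Base u₂Ψ′A₁)` with `θ(β₁^* Div φ) = β₂^* Div(Ψ′φ) = θ′(β₁^* Div φ)` for every
arrow `φ` out of `A₁` are EQUAL — every element of `Φ₁^pf(Base A₁)` is `Div φ` for such a `φ` (Def. 1.3 (iii)(d)
for `((C₁)^pf)^un-tr`) and `β₁^*` is a bijection. [cite: MochizukiFrdI2008, Thm. 6.4 (iii) p.115] -/
theorem arith_transport_unique_of_divClause
    (u₁ : (PreFrobenioidData.ofFunctor _
        (PreFrobenioid.Perfection.ops (arithFrobenioid_isFrobenioid F₁ K₁)).toFunctor).Untr ⥤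
      PreFrobenioid.rlf (ModelFrobenioid.toElem (arithDivisorFunctor F₁ K₁) (unitsFunctor F₁ K₁)
        (divNatTrans F₁ K₁)) hΦ₁)
    (β₁ : u₁ ⋙ (arithRealification hΦ₁).ops.base ≅
      (PreFrobenioidData.ofFunctor _ (untrFunctor (arith_pf_isFrobenioid F₁ K₁))).base)
    (u₂ : (PreFrobenioidData.ofFunctor _
        (PreFrobenioid.Perfection.ops (arithFrobenioid_isFrobenioid F₂ K₂)).toFunctor).Untr ⥤
      PreFrobenioid.rlf (ModelFrobenioid.toElem (arithDivisorFunctor F₂ K₂) (unitsFunctor F₂ K₂)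
        (divNatTrans F₂ K₂)) hΦ₂)
    (β₂ : u₂ ⋙ (arithRealification hΦ₂).ops.base ≅
      (PreFrobenioidData.ofFunctor _ (untrFunctor (arith_pf_isFrobenioid F₂ K₂))).base)
    (Ψ' : (PreFrobenioidData.ofFunctor _
        (PreFrobenioid.Perfection.ops (arithFrobenioid_isFrobenioid F₁ K₁)).toFunctor).Untr ⥤
      (PreFrobenioidData.ofFunctor _
        (PreFrobenioid.Perfection.ops (arithFrobenioid_isFrobenioid F₂ K₂)).toFunctor).Untr)
    (A₁ : (PreFrobenioidData.ofFunctor _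
      (PreFrobenioid.Perfection.ops (arithFrobenioid_isFrobenioid F₁ K₁)).toFunctor).Untr)
    (θ θ' : (PreFrobenioidData.ofFunctor _ (untrFunctor (arith_pf_isFrobenioid F₁ K₁))).Mon
        ((arithRealification hΦ₁).ops.base.obj (u₁.obj A₁)) →
      (PreFrobenioidData.ofFunctor _ (untrFunctor (arith_pf_isFrobenioid F₂ K₂))).Mon
        ((arithRealification hΦ₂).ops.base.obj (u₂.obj (Ψ'.obj A₁))))
    (hθ : ∀ ⦃B : (PreFrobenioidData.ofFunctor _
        (PreFrobenioid.Perfection.ops (arithFrobenioid_isFrobenioid F₁ K₁)).toFunctor).Untr⦄ (φ : A₁ ⟶ B),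
      θ ((PreFrobenioidData.ofFunctor _ (untrFunctor (arith_pf_isFrobenioid F₁ K₁))).pull (β₁.hom.app A₁)
          ((PreFrobenioidData.ofFunctor _ (untrFunctor (arith_pf_isFrobenioid F₁ K₁))).div φ)) =
        (PreFrobenioidData.ofFunctor _ (untrFunctor (arith_pf_isFrobenioid F₂ K₂))).pull (β₂.hom.app (Ψ'.obj A₁))
          ((PreFrobenioidData.ofFunctor _ (untrFunctor (arith_pf_isFrobenioid F₂ K₂))).div (Ψ'.map φ)))
    (hθ' : ∀ ⦃B : (PreFrobenioidData.ofFunctor _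
        (PreFrobenioid.Perfection.ops (arithFrobenioid_isFrobenioid F₁ K₁)).toFunctor).Untr⦄ (φ : A₁ ⟶ B),
      θ' ((PreFrobenioidData.ofFunctor _ (untrFunctor (arith_pf_isFrobenioid F₁ K₁))).pull (β₁.hom.app A₁)
          ((PreFrobenioidData.ofFunctor _ (untrFunctor (arith_pf_isFrobenioid F₁ K₁))).div φ)) =
        (PreFrobenioidData.ofFunctor _ (untrFunctor (arith_pf_isFrobenioid F₂ K₂))).pull (β₂.hom.app (Ψ'.obj A₁))
          ((PreFrobenioidData.ofFunctor _ (untrFunctor (arith_pf_isFrobenioid F₂ K₂))).div (Ψ'.map φ))) :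
    θ = θ' := by
  refine funext fun x => ?_
  -- `x = β₁^* m` for `m := (β₁⁻¹)^* x`, and `m = Div φ`
  obtain ⟨B, φ, hφ⟩ := arith_pfUntr_div_surjective A₁
    ((PreFrobenioidData.ofFunctor _ (untrFunctor (arith_pf_isFrobenioid F₁ K₁))).pull (β₁.inv.app A₁) x)
  have hx : (PreFrobenioidData.ofFunctor _ (untrFunctor (arith_pf_isFrobenioid F₁ K₁))).pull (β₁.hom.app A₁)
      ((PreFrobenioidData.ofFunctor _ (untrFunctor (arith_pf_isFrobenioid F₁ K₁))).div φ) = x :=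
    (congrArg (fun m => (PreFrobenioidData.ofFunctor _ (untrFunctor (arith_pf_isFrobenioid F₁ K₁))).pull
      (β₁.hom.app A₁) m) hφ).trans
      (DFunLike.congr_fun ((PreFrobenioidData.ofFunctor _
        (untrFunctor (arith_pf_isFrobenioid F₁ K₁))).pull_hom_comp_pull_inv (β₁.app A₁)) x)
  rw [← hx, hθ φ, hθ' φ]

/-- **[FrdI] Theorem 6.4 (iii) AS TYPED (`Thm64iii`), AT THE CONSTRUCTIONS and AT THE COMPARISON FUNCTORS of
Prop. 5.3, for an ARBITRARY `Ψ′ : ((C₁)^pf)^un-tr ⥲ ((C₂)^pf)^un-tr` and an ARBITRARY `Ψ^rlf` arising from it.**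
There exist THE comparison functors `u_i : ((C_{K_i/F_i})^pf)^un-tr → C_{K_i/F_i}^rlf` with base isomorphisms
`β_i : u_i ⋙ Base ≅ Base`, carrying `Div φ` to `β_i^* ι(Div φ)` and preserving `deg_Fr`, such that for every
`Ψ^rlf`, `Ψ′`, every square `σ : Ψ′ ⋙ u₂ ≅ u₁ ⋙ Ψ^rlf` and every object `A₁`: there is THE perfected divisor
transport `θ` of `Ψ′` at `A₁` (carrying `β₁^* Div φ` to `β₂^* Div(Ψ′φ)`), THE induced `picMap` with `Thm64ii`, and
THE bijection of places `placeMap` induced by `θ`, with `Thm64iii R₁ R₂ Ψ^rlf picMap deg u₁ u₂ Ψ′ A₁ placeMap` for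
every `deg`. [cite: MochizukiFrdI2008, Thm. 6.4 (iii) p.114] -/
theorem Thm64iii_arith_general_at_comparison :
    ∃ (u₁ : (PreFrobenioidData.ofFunctor _
          (PreFrobenioid.Perfection.ops (arithFrobenioid_isFrobenioid F₁ K₁)).toFunctor).Untr ⥤
        PreFrobenioid.rlf (ModelFrobenioid.toElem (arithDivisorFunctor F₁ K₁) (unitsFunctor F₁ K₁)
          (divNatTrans F₁ K₁)) hΦ₁)
      (β₁ : u₁ ⋙ (arithRealification hΦ₁).ops.base ≅
        (PreFrobenioidData.ofFunctor _ (untrFunctor (arith_pf_isFrobenioid F₁ K₁))).base)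
      (u₂ : (PreFrobenioidData.ofFunctor _
          (PreFrobenioid.Perfection.ops (arithFrobenioid_isFrobenioid F₂ K₂)).toFunctor).Untr ⥤
        PreFrobenioid.rlf (ModelFrobenioid.toElem (arithDivisorFunctor F₂ K₂) (unitsFunctor F₂ K₂)
          (divNatTrans F₂ K₂)) hΦ₂)
      (β₂ : u₂ ⋙ (arithRealification hΦ₂).ops.base ≅
        (PreFrobenioidData.ofFunctor _ (untrFunctor (arith_pf_isFrobenioid F₂ K₂))).base),
      -- `u₁` lies over `F_ι` in `Div` and `deg_Fr`
      (∀ ⦃A B : (PreFrobenioidData.ofFunctor _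
          (PreFrobenioid.Perfection.ops (arithFrobenioid_isFrobenioid F₁ K₁)).toFunctor).Untr⦄ (φ : A ⟶ B),
        (arithRealification hΦ₁).ops.div (u₁.map φ) =
          (arithRealification hΦ₁).ops.pull (β₁.hom.app A)
            ((PreFrobenioid.IsPerfFactorialOn.op hΦ₁ (op _)).toRealification
              ((PreFrobenioidData.ofFunctor _ (untrFunctor (arith_pf_isFrobenioid F₁ K₁))).div φ))) ∧
      (∀ ⦃A B : (PreFrobenioidData.ofFunctor _
          (PreFrobenioid.Perfection.ops (arithFrobenioid_isFrobenioid F₁ K₁)).toFunctor).Untr⦄ (φ : A ⟶ B),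
        (arithRealification hΦ₁).ops.degFr (u₁.map φ) =
          (PreFrobenioidData.ofFunctor _ (untrFunctor (arith_pf_isFrobenioid F₁ K₁))).degFr φ) ∧
      -- `u₂` lies over `F_ι` in `Div` and `deg_Fr`
      (∀ ⦃A B : (PreFrobenioidData.ofFunctor _
          (PreFrobenioid.Perfection.ops (arithFrobenioid_isFrobenioid F₂ K₂)).toFunctor).Untr⦄ (φ : A ⟶ B),
        (arithRealification hΦ₂).ops.div (u₂.map φ) =
          (arithRealification hΦ₂).ops.pull (β₂.hom.app A)
            ((PreFrobenioid.IsPerfFactorialOn.op hΦ₂ (op _)).toRealification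
              ((PreFrobenioidData.ofFunctor _ (untrFunctor (arith_pf_isFrobenioid F₂ K₂))).div φ))) ∧
      (∀ ⦃A B : (PreFrobenioidData.ofFunctor _
          (PreFrobenioid.Perfection.ops (arithFrobenioid_isFrobenioid F₂ K₂)).toFunctor).Untr⦄ (φ : A ⟶ B),
        (arithRealification hΦ₂).ops.degFr (u₂.map φ) =
          (PreFrobenioidData.ofFunctor _ (untrFunctor (arith_pf_isFrobenioid F₂ K₂))).degFr φ) ∧
      -- Thm. 6.4 (iii) for every `Ψ^rlf` arising from a `Ψ′` through THESE comparison functors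
      ∀ (Ψrlf : PreFrobenioid.rlf (ModelFrobenioid.toElem (arithDivisorFunctor F₁ K₁) (unitsFunctor F₁ K₁)
            (divNatTrans F₁ K₁)) hΦ₁ ≌
          PreFrobenioid.rlf (ModelFrobenioid.toElem (arithDivisorFunctor F₂ K₂) (unitsFunctor F₂ K₂)
            (divNatTrans F₂ K₂)) hΦ₂)
        (Ψ' : (PreFrobenioidData.ofFunctor _
            (PreFrobenioid.Perfection.ops (arithFrobenioid_isFrobenioid F₁ K₁)).toFunctor).Untr ≌
          (PreFrobenioidData.ofFunctor _
            (PreFrobenioid.Perfection.ops (arithFrobenioid_isFrobenioid F₂ K₂)).toFunctor).Untr)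
        (_σ : Ψ'.functor ⋙ u₂ ≅ u₁ ⋙ Ψrlf.functor)
        (A₁ : (PreFrobenioidData.ofFunctor _
          (PreFrobenioid.Perfection.ops (arithFrobenioid_isFrobenioid F₁ K₁)).toFunctor).Untr),
        ∃ θ : Perfection (Multiplicative (EffArithDivisor
              ((arithRealification hΦ₁).ops.base.obj (u₁.obj A₁)).L)) ≃*
            Perfection (Multiplicative (EffArithDivisor
              ((arithRealification hΦ₂).ops.base.obj (u₂.obj (Ψ'.functor.obj A₁))).L)),
          (∀ ⦃B : (PreFrobenioidData.ofFunctor _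
              (PreFrobenioid.Perfection.ops (arithFrobenioid_isFrobenioid F₁ K₁)).toFunctor).Untr⦄ (φ : A₁ ⟶ B),
            θ ((PreFrobenioidData.ofFunctor _ (untrFunctor (arith_pf_isFrobenioid F₁ K₁))).pull (β₁.hom.app A₁)
                ((PreFrobenioidData.ofFunctor _ (untrFunctor (arith_pf_isFrobenioid F₁ K₁))).div φ)) =
              (PreFrobenioidData.ofFunctor _ (untrFunctor (arith_pf_isFrobenioid F₂ K₂))).pull
                (β₂.hom.app (Ψ'.functor.obj A₁))
                ((PreFrobenioidData.ofFunctor _ (untrFunctor (arith_pf_isFrobenioid F₂ K₂))).div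
                  (Ψ'.functor.map φ))) ∧
          ∃ picMap : ∀ A, (arithRealification hΦ₁).Pic A ≃+ (arithRealification hΦ₂).Pic (Ψrlf.functor.obj A),
            Thm64ii (arithRealification hΦ₁) (arithRealification hΦ₂) Ψrlf picMap ∧
            ∃ placeMap : Places ((arithRealification hΦ₁).ops.base.obj (u₁.obj A₁)).L ≃
                Places ((arithRealification hΦ₂).ops.base.obj (u₂.obj (Ψ'.functor.obj A₁))).L,
              (∀ v, Primes.congr θ (Quotient.mk (primarySetoid _) ⟨_, EffArithDivisor.isPrimary_of_single _ v⟩) =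
                Quotient.mk (primarySetoid _) ⟨_, EffArithDivisor.isPrimary_of_single _ (placeMap v)⟩) ∧
              ∀ deg : ℝ, Thm64iii (arithRealification hΦ₁) (arithRealification hΦ₂) Ψrlf picMap deg u₁ u₂ Ψ'
                A₁ placeMap := by
  -- THE comparison functors with their base isomorphisms, Div-clauses and degree clauses (abc-iut-L1-d1)
  refine (arith_exists_comparisonFunctor_pfUntr_rlf_degFr hΦ₁).elim fun u₁ h₁ => h₁.elim fun β₁ hu₁ => ?_
  refine (arith_exists_comparisonFunctor_pfUntr_rlf_degFr hΦ₂).elim fun u₂ h₂ => h₂.elim fun β₂ hu₂ => ?_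
  -- the corollary with `hG2` discharged (abc-iut-L1-d2), at these `u_i`; `σ` is the one binder left
  exact ⟨u₁, β₁, u₂, β₂, hu₁.1, hu₁.2, hu₂.1, hu₂.2, fun Ψrlf Ψ' σ A₁ =>
    Thm64iii_arith_general_of_square hΦ₁ hΦ₂ Ψrlf u₁ β₁ hu₁.1 u₂ β₂ hu₂.1 Ψ' σ A₁⟩

end Arith

end Literature.AlgebraicGeometry.Frobenioids

end
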